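import Summits.BirchSwinnertonDyer.BirchSwinnertonDyer.Theorems.ByReductionTypeAtTwoMultSlopePinch
import Summits.BirchSwinnertonDyer.Rank1Residual.X5.TwoAdicInstancesINT412830t
import HarnessLib

/-!
# Route `ByReductionTypeAtTwo` / S3ᵐ twin: the SLOPE-PINCH door in CONVERSE form at a non-split multiplicative `2`
# (`Sel_{2^∞}(E/ℚ)` finite ⇒ `L(E,1) ≠ 0 ∧ r_an(E) = 0`), and its instance at the class 412830t

HONEST FRAMING (cell `bsd-2adic`, run/shared/lean/pub/bsd-2adic/, seat `bsd-2adic-mult-3` GEN 9, HUMAN RULINGS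
D-0036 / D-0054 / D-0074 row (A)): research route; THEOREMS ONLY; nothing asserted, nothing booked; BSD is not proved
by any of this. PARTITION: none — RANK axis (S3ᵐ: the rank-`0` `2`-converse at a non-split multiplicative `2`,
items 19219 / 19187 per class); companion formula cell X5@2 mult (K4ᵐ, item 19923's residue class 412830t).

The converse twin of `MultSlopePinch.bsdp_two_nonsplit_of_katoInt_slopePinch` (file `…MultSlopePinch`, this seat):
same MEMO {T-KATO2-NSMULT `hKint`} + PRINT {guarded Thm-4.1 analogue `h41`, `hmod`, Prop. 4.14@2 `h414` (+ Česnavičius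
`hC` in the display form)} + CERTIFICATES {`μ_an = 0`, the coefficient valuations `hcoef` (`v₂(c₀) = s ≠ 0` even,
`2^t ∣ c₁`, `v₂(c₂) = 1`, `s + 2 ≤ 2t`), the layer count `2³ ≤ #Sel_{2^∞}(E/ℚ_j)[2]`, `2 ≤ #Sel_{2^∞}(E/ℚ)[2]`},
MINUS analytic rank `0` and GZK, PLUS `Sel_{2^∞}(E/ℚ)` finite: then `char_Λ X = (L₀)` by the slope pinch and
`entireLFunction_one_ne_zero_of_finite_selmer_of_charIdeal_eq_span_nonsplit` (A235: `L₀(0) ≠ 0 ⇒ L(E,1) ≠ 0`).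
* `analyticRank_eq_zero_of_finite_selmer_of_katoInt_slopePinch` (+ `_display`), and the class instance
  `MultK4.analyticRank_eq_zero_412830t1_of_finite_selmer_slope` (the fourth «K = 4» singleton; the other three are
  `MultK4.analyticRank_eq_zero_<lab>_of_finite_selmer_layer`, this seat GEN 6).

References: R. Greenberg, LNM 1716 (1999), §4 pp. 112–113, Prop. 4.14 (p. 124); B. Mazur, J. Tate, J. Teitelbaum,
Invent. Math. 84 (1986), §I.14; K. Česnavičius, Compos. Math. 154 (2018), Thm. 1.2; L. Washington, *Introduction to
Cyclotomic Fields*, §7.1.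
-/

set_option autoImplicit false
set_option linter.dupNamespace false

noncomputable section

open scoped Classical MatrixGroups ModularForm

open CongruenceSubgroup WeierstrassCurve Literature.NumberTheory.EllipticCurves
  Literature.NumberTheory.EllipticCurves.ModularForms
  Literature.NumberTheory.EllipticCurves.Wuthrich2014
  Literature.NumberTheory.EllipticCurves.Greenberg1999
  Literature.NumberTheory.EllipticCurves.Rank1Residual
  Literature.NumberTheory.EllipticCurves.Rank1Residual.Typed Summit.BirchSwinnertonDyer.Rank1Residual
  Summit.BirchSwinnertonDyer.Rank1Residual.X5 Summit.BirchSwinnertonDyer.Rank1Residual.X5.O1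
  Summit.BirchSwinnertonDyer.Rank1Residual.X5.Instances
  Summit.BirchSwinnertonDyer.BirchSwinnertonDyer.Theorems.MultSelmerRank

namespace Summit.BirchSwinnertonDyer.BirchSwinnertonDyer.Theorems.MultSlopePinch

variable (W : WeierstrassCurve ℚ) [W.IsElliptic] [W.IsGloballyMinimal]

/-- **DOOR (SLOPE pinch, non-split), CONVERSE FORM** (S3ᵐ lane, rank-`0` `2`-converse at the class): the inputs of
`bsdp_two_nonsplit_of_katoInt_slopePinch` MINUS analytic rank `0` and GZK, PLUS `s ≠ 0`; `Sel_{2^∞}(E/ℚ)` finite ⇒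
`L(E,1) ≠ 0 ∧ r_an(E) = 0`. Chain: `hKint` ⇒ `X` torsion ∧ `L₀ ∈ char X`; §1 of `…MultSlopePinch` (with the GIVEN
finiteness) ⇒ `v₂(f_X(0)) ≥ 2`; the slope pinch ⇒ `char X = (L₀)`; A235 ⇒ `L₀(0) ≠ 0` ⇒ `L(E,1) ≠ 0`.
[cite: GreenbergLNM1716, §4 pp. 112–113 and Prop. 4.14 (p. 124)] [cite: MazurTateTeitelbaum1986Invent, §I.14]
[cite: Washington1997, §7.1] -/
theorem analyticRank_eq_zero_of_finite_selmer_of_katoInt_slopePinch {j s t : ℕ}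
    (h41 : thm41Analogue_charValue_rankZero_numberField_anyPrime_oddLocalDegree)
    (hmod : nonempty_modularParametrizationData)
    (h414 : prop414_noFiniteSubmodule_of_not_dvd_torsionOrder)
    (hKint : KatoDivisibilityAtTwoNonsplitMultInt W)
    (hper₀ : ∀ [NeZero (W.conductorNorm ℤ)] (f : CuspForm (Gamma0 (W.conductorNorm ℤ)) 2),
      IsNewformOf W f → ∀ ϖ : ℚ, (ϖ : ℝ) * W.realPeriodRat = plusPeriod f → 0 ≤ padicValRat 2 ϖ)
    (hmult : Mult W 2) (hns : ¬ W.HasSplitMultiplicativeReductionAtPrime 2)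
    (him : TwoAdicSurjective W) (hΔ : W.Δ < 0) (hμan : X2.AnalyticMuLE W 2 0)
    (hcoef : ∀ {N : ℕ} [NeZero N] (f : CuspForm (Gamma0 N) 2), IsNewformOf W f →
      ∀ (ϖ : ℚ), (ϖ : ℝ) * W.realPeriodRat = plusPeriod f →
      ∀ (L : PowerSeries ℚ_[2]), IsMultPAdicLFunctionOf f 2 (-1) L →
      ∀ (G : IwasawaAlgebra 2), iwasawaToPowerSeries 2 G = PowerSeries.C (ϖ : ℚ_[2]) * L →
        (PowerSeries.coeff 0 G).valuation = s ∧ (2 : ℤ_[2]) ^ t ∣ PowerSeries.coeff 1 G ∧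
          PowerSeries.coeff 2 G ≠ 0 ∧ (PowerSeries.coeff 2 G).valuation = 1)
    (hse : Even s) (hst : s + 2 ≤ 2 * t) (hs0 : s ≠ 0)
    (hsel : ∀ κ : ZpExtension ℚ 2, κ.IsCyclotomic →
      2 ^ 3 ≤ Nat.card {z : W.selmerLayer κ j // 2 • z = 0})
    (hsel₀ : 2 ≤ Nat.card {z : W.selmerGroupPInfty 2 // 2 • z = 0})
    (hfin : Finite (W.selmerGroupPInfty 2)) : W.entireLFunction 1 ≠ 0 ∧ W.analyticRank = 0 := by
  haveI : NeZero (W.conductorNorm ℤ) := ⟨(W.conductorNorm_pos_holds).ne'⟩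
  obtain ⟨Dm⟩ := hmod W
  have hf : IsNewformOf W Dm.f := Dm.isNewformOf
  obtain ⟨ϖ, -, hϖ, -⟩ := Dm.exists_rat_mul_realPeriodRat_eq_plusPeriod
  obtain ⟨κ, hκ, γ, hγ, hγ'⟩ := exists_isCyclotomic_isTopGenerator_isCyclotomicVariable_holds 2
  obtain ⟨DW⟩ := W.nonempty_selmerDualData_holds κ γ hγ
  obtain ⟨L, hLf⟩ := exists_isMultPAdicLFunctionOf_neg_one_of_nonsplit hf hmult hns
  obtain ⟨L₀, hL₀⟩ := exists_iwasawaToPowerSeries_eq_C_mul_of_isMultPAdicLFunctionOf_neg_one_two hf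
    hmult hns (hper₀ Dm.f hf ϖ hϖ) hLf
  obtain ⟨hX, hKL₀⟩ := hKint hmult hns him hΔ Dm.f hf L hLf κ γ hκ hγ hγ' DW ϖ hϖ L₀ hL₀
  have htors : ¬ 2 ∣ W.torsionOrder := not_two_dvd_torsionOrder_of_twoAdicSurjective W him
  have hf0 : ∀ fE : IwasawaAlgebra 2, DW.charIdeal = Ideal.span {fE} →
      2 ≤ (PowerSeries.constantCoeff fE).valuation := fun fE hfE =>
    two_le_valuation_constantCoeff_of_eulerChar W (twoAdicEulerCharRankZeroNonsplitMult_zero_of_greenberg' W h41)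
      hmult hns htors hκ hγ hγ' DW hX hfE hfin hsel₀
  obtain ⟨hs, hc1, hc2⟩ := hcoef Dm.f hf ϖ hϖ L hLf L₀ hL₀
  have hc0 : PowerSeries.coeff 0 L₀ ≠ 0 := by
    intro h0
    rw [h0, PadicInt.valuation_zero] at hs
    exact hs0 hs.symm
  have hchar := charIdeal_eq_span_of_katoInt_slopePinch_nonsplit W hns hμan hκ hγ hγ' hf hLf DW hX hϖ hL₀ hKL₀
    (selmerLambdaLowerBoundAtTwo_of_layerSelmer W h414 htors hsel) hf0 hc0 hs hc1 hc2 hse hst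
  exact entireLFunction_one_ne_zero_of_finite_selmer_of_charIdeal_eq_span_nonsplit W
    (twoAdicEulerCharRankZeroNonsplitMult_zero_of_greenberg' W h41) hmult hns hκ hγ hγ' hf hLf DW hX hL₀
    hchar hfin

/-- **CONVERSE FORM, DISPLAY: `hper₀` DISCHARGED by Česnavičius** (on the surjective locus `ord₂ ϖ = 0`).
[cite: Cesnavicius2018, Thm. 1.2] [cite: GreenbergLNM1716, §4 pp. 112–113 and Prop. 4.14 (p. 124)] -/
theorem analyticRank_eq_zero_of_finite_selmer_of_katoInt_slopePinch_display {j s t : ℕ}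
    (h41 : thm41Analogue_charValue_rankZero_numberField_anyPrime_oddLocalDegree)
    (hmod : nonempty_modularParametrizationData)
    (h414 : prop414_noFiniteSubmodule_of_not_dvd_torsionOrder)
    (hC : cesnavicius_not_two_dvd_maninConstant_of_two_dvd_level)
    (hKint : KatoDivisibilityAtTwoNonsplitMultInt W)
    (hmult : Mult W 2) (hns : ¬ W.HasSplitMultiplicativeReductionAtPrime 2)
    (him : TwoAdicSurjective W) (hΔ : W.Δ < 0) (hμan : X2.AnalyticMuLE W 2 0)
    (hcoef : ∀ {N : ℕ} [NeZero N] (f : CuspForm (Gamma0 N) 2), IsNewformOf W f →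
      ∀ (ϖ : ℚ), (ϖ : ℝ) * W.realPeriodRat = plusPeriod f →
      ∀ (L : PowerSeries ℚ_[2]), IsMultPAdicLFunctionOf f 2 (-1) L →
      ∀ (G : IwasawaAlgebra 2), iwasawaToPowerSeries 2 G = PowerSeries.C (ϖ : ℚ_[2]) * L →
        (PowerSeries.coeff 0 G).valuation = s ∧ (2 : ℤ_[2]) ^ t ∣ PowerSeries.coeff 1 G ∧
          PowerSeries.coeff 2 G ≠ 0 ∧ (PowerSeries.coeff 2 G).valuation = 1)
    (hse : Even s) (hst : s + 2 ≤ 2 * t) (hs0 : s ≠ 0)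
    (hsel : ∀ κ : ZpExtension ℚ 2, κ.IsCyclotomic →
      2 ^ 3 ≤ Nat.card {z : W.selmerLayer κ j // 2 • z = 0})
    (hsel₀ : 2 ≤ Nat.card {z : W.selmerGroupPInfty 2 // 2 • z = 0})
    (hfin : Finite (W.selmerGroupPInfty 2)) : W.entireLFunction 1 ≠ 0 ∧ W.analyticRank = 0 :=
  analyticRank_eq_zero_of_finite_selmer_of_katoInt_slopePinch W h41 hmod h414 hKint
    (periodRatio_nonneg_of_twoAdicSurjective_of_cesnavicius W hC hmult him) hmult hns him hΔ hμan hcoef hse hst hs0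
    hsel hsel₀ hfin

end Summit.BirchSwinnertonDyer.BirchSwinnertonDyer.Theorems.MultSlopePinch

namespace Summit.BirchSwinnertonDyer.BirchSwinnertonDyer.Theorems.MultK4

open Summit.BirchSwinnertonDyer.BirchSwinnertonDyer.Theorems.MultSlopePinch

/-- **Rank-`0` `2`-CONVERSE AT 412830t1 by the slope pinch** (S3ᵐ lane): `Sel_{2^∞}(E/ℚ)` finite ⇒
`L(E,1) ≠ 0 ∧ r_an = 0`, from PRINT {`hDD`, `h41`, `hmod`, `h414`, `hC`} + MEMO {T-KATO2-NSMULT `hKint`} + CERT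
{`μ_an = 0`; `v₂(c₀) = 10`, `2⁶ ∣ c₁`, `v₂(c₂) = 1` (CERT-SLOPE-412830t.md, two-engine); `2⁴ ≤ #Sel_{2^∞}(E/ℚ_2)[2]`;
`2² ≤ #Sel_{2^∞}(E/ℚ)[2]`}. [cite: GreenbergLNM1716, §4 pp. 112–113 and Prop. 4.14 (p. 124)]
[cite: DokchitserDokchitserMathZ2012, Theorem (p. 961)] [cite: MazurTateTeitelbaum1986Invent, §I.14] -/
theorem analyticRank_eq_zero_412830t1_of_finite_selmer_slope
    (hDD : DokchitserDokchitser2012_surjective_mod_two_four_eight)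
    (h41 : thm41Analogue_charValue_rankZero_numberField_anyPrime_oddLocalDegree)
    (hmod : nonempty_modularParametrizationData) (h414 : prop414_noFiniteSubmodule_of_not_dvd_torsionOrder)
    (hC : cesnavicius_not_two_dvd_maninConstant_of_two_dvd_level)
    (hKint : KatoDivisibilityAtTwoNonsplitMultInt c412830t1) (hμan : X2.AnalyticMuLE c412830t1 2 0)
    (hcoef : ∀ {N : ℕ} [NeZero N] (f : CuspForm (Gamma0 N) 2), IsNewformOf c412830t1 f →
      ∀ (ϖ : ℚ), (ϖ : ℝ) * c412830t1.realPeriodRat = plusPeriod f →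
      ∀ (L : PowerSeries ℚ_[2]), IsMultPAdicLFunctionOf f 2 (-1) L →
      ∀ (G : IwasawaAlgebra 2), iwasawaToPowerSeries 2 G = PowerSeries.C (ϖ : ℚ_[2]) * L →
        (PowerSeries.coeff 0 G).valuation = 10 ∧ (2 : ℤ_[2]) ^ 6 ∣ PowerSeries.coeff 1 G ∧
          PowerSeries.coeff 2 G ≠ 0 ∧ (PowerSeries.coeff 2 G).valuation = 1)
    (hsel : ∀ κ : ZpExtension ℚ 2, κ.IsCyclotomic →
      2 ^ 4 ≤ Nat.card {z : c412830t1.selmerLayer κ 2 // 2 • z = 0})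
    (hsel₀ : 2 ^ 2 ≤ Nat.card {z : c412830t1.selmerGroupPInfty 2 // 2 • z = 0})
    (hfin : Finite (c412830t1.selmerGroupPInfty 2)) :
    c412830t1.entireLFunction 1 ≠ 0 ∧ c412830t1.analyticRank = 0 :=
  analyticRank_eq_zero_of_finite_selmer_of_katoInt_slopePinch_display c412830t1 h41 hmod h414 hC hKint
    mult_two_412830t1 not_split_two_412830t1 (surj_two_412830t1 hDD) delta_neg_412830t1 hμan hcoef (by decide)
    (by norm_num) (by norm_num) (fun κ hκ => le_trans (by norm_num) (hsel κ hκ)) (le_trans (by norm_num) hsel₀) hfin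

end Summit.BirchSwinnertonDyer.BirchSwinnertonDyer.Theorems.MultK4

end
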